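import Summits.BirchSwinnertonDyer.BirchSwinnertonDyer.Theorems.EdixhovenFibreFiveSevenStarredOptimalManinUnitFiveSevenSemiLocalIntegrality
import Summits.BirchSwinnertonDyer.BirchSwinnertonDyer.Theorems.KimAtThreeDeepUpperExpStarFactsTower
import Summits.BirchSwinnertonDyer.BirchSwinnertonDyer.Theorems.KimAtThreeFineKatoLevelCompat
import HarnessLib

/-!
# F″ programme, piece P4-coh part 2: for a Néron-PINNED Kato datum (the P1 draft's currency) EVERY semi-local value
# `Ψ (Λ y) w` is a `w`-adic integer — the `hint` binder of the semi-local descent P4-core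
# (route `EdixhovenFibreFiveSeven`, crux K★ stmt-BirchSwinnertonDyer-22226, line `kato-lever`; seat `bsd-line-edix-p3` g4)

HONEST FRAMING. TOOL theorems only (no definition, no named fact, no `sorry`); nothing is closed or booked; BSD is
not proved by any of this. §1–§2 consume no cite fact; §3 is CONDITIONAL on three cite-only Literature facts, DISPLAYED
as hypotheses: (S5b-tower) `PAdicHodge.exists_smul_range_expStarCoord_tower_iff_trace_log` and Kato's Prop. 1.2.3
`PAdicHodge.cupLogInjective_and_hasDualExp_of_isDeRham`, `PAdicHodge.isDeRham_restrictedRationalTateRep`.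

WHY. The P1 draft of the F″ programme (`Cruxes/ManinFrameResidueProper/Lines/P1_DRAFT_KatoSL2NeronValues_manin_p1_g8.lean`,
seat manin-p1 g8; Kato (8.1.3) + 9.7 + 6.6 (1) + 13.6 at Kato's member with the dual exponential DEFINED) states
(a) its semi-local clause at a GENERAL level `m` over the subgroup `rootsOfUnityFixer ℚ m`, with the membership
`absGaloisRestrictTower ℚ ℚ_v L_w σ ∈ rootsOfUnityFixer ℚ m` QUANTIFIED in its (DEF_w) clause, and (b) its PIN in
(S5b)'s Literature currency: `∀` compatible `wv` on `ℚ_v` making `W ⊗ ℚ_v` integral,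
`range(expStarCoord W _ d₀) = {a : ∀ P, ‖Tr_{ℚ_v/ℚ_p}(a · padicLogPointFiniteExt wv (W ⊗ ℚ_v) p P)‖ ≤ 1}`.
The consumer (P4-coh part 1, `…SemiLocalIntegrality.expStarOmegaHom_mem_adicCompletionIntegers_of_katoClause`,
p601236) wants W2's `hdual` shape (classes, `ℚ_p`, `LocalLog.padicLog`, read through `e_p⁻¹`) and a tower cocycle.
THIS FILE supplies the two plumbing facts, `p`- and `m`-generic, and then the consumer-shaped theorem:

* §1 `absGaloisRestrictTower_adicCompletion_mem_rootsOfUnityFixer` — for `L = ℚ(ζ_m)` and ANY place `w` of `L`,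
  the tower restriction `Γ_{L_w} → Γ_{ℚ_v} → Γ_ℚ` lands in `rootsOfUnityFixer ℚ m` (the completion contains `ζ_m`;
  `IsScalarTower ℚ ℚ_v L_w` because ring maps out of `ℚ` are unique) — the `p`- and `m`-generic twin of the PRIVATE
  `Kato2004.absGaloisRestrictTower_completion_mem_cycSubgroup` (levels `cycLevel p k r`) and of kim3's
  `absGaloisRestrictTower_adicCompletion_mem_cycSubgroup` (`p = 3`); it discharges the `hσ` binder of P1's (DEF_w) and
  keys `absGaloisRestrictTowerInto` / `locTower` of `LevelFieldLocalization` at `U := rootsOfUnityFixer ℚ m`.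
* §2 `hdual_of_pin` — **P1's PIN (Literature currency, `∀ wv`) ⟹ W2's `hdual` for EVERY `ι : ℚ_v →+* ℚ_p`**
  (`(∃ y, expStarOmegaPadicAt d hinj hex ι y = a) ↔ ∀ Q ∈ E(ℚ_p), ‖a · log_ω Q‖ ≤ 1`): the reading of
  `KimAtThreeDeepUpperExpStarFacts.hdual_of_facts` (PIN at `wv := ‖padicEquiv ·‖`, `Tr_{ℚ_v/ℚ_p} = padicEquiv`,
  logarithm and points transported along `padicEquiv`, rigidity `ringHom_place_padic_ext`) with the cite fact (S5b)
  replaced by the PIN hypothesis and the rescaling `e = 1`.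
* §3 ★★★ `semilocal_mem_adicCompletionIntegers_of_pin_of_semi` — **P4-coh in the P1 draft's currency**: for `W/ℚ`
  globally minimal, `5 ≤ p`, `Addv W p`, `d₀` with (PIN), a level `m` with `p ∤ m`, F″'s clause, ANY `Λ` on
  `H1 (tateRep W p) (rootsOfUnityFixer ℚ m)` and ANY `Ψ`, the per-place clause (RES_w) ∧ (DEF_w) VERBATIM ⟹
  `∀ y w, Ψ (Λ y) w ∈ 𝒪_w` — EXACTLY the `hint` binder of
  `SemiLocalDescent.exists_not_dvd_isIntegral_charSum_of_forall_semilocal_mem` (p598912). With it the F″ programme's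
  provable glue is complete: F″ ⟸ P1 (the draft fact, once filed) ∧ (S5b-tower) ∧ Prop. 1.2.3 ∧ [level = conductor],
  by P6 ∘ value exit ∘ units ∘ P4-core ∘ THIS ∘ receptacle (assembler: edix-p4 g3).

References: [Kato1993LNM1553] Ch. II §1.2.4, Thm. 1.4.1 (3)–(4); [BlochKato1990] §3 Prop. 3.8, Ex. 3.11;
[NeukirchANT1999] Ch. IV §1; [Rubin2000] Ch. IV §4; [SerreLocalFields1979] Ch. II §5; [SilvermanAEC2009] IV.6.4,
VII.2.2; [Kato2004Asterisque] §9.4, Thm. 9.7 (the consumer's context).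
-/

set_option autoImplicit false
-- the Theorems namespace of a single-conjunct summit repeats the summit name by design (D-0017)
set_option linter.dupNamespace false

noncomputable section

open scoped NumberField NNReal Classical TensorProduct
open Field ValuativeRel IsDedekindDomain NumberField
open Literature.NumberTheory.GaloisRepresentations
open Literature.NumberTheory.GaloisRepresentations.PeriodRingData
open Literature.NumberTheory.PAdicHodge
open Literature.NumberTheory.EllipticCurves WeierstrassCurve
open Literature.NumberTheory.EllipticCurves.FormalGroupChart (padicLogPointFiniteExt
  isIntegral_valuationInteger_of_isIntegral_padicInt)
open Summit.BirchSwinnertonDyer.BirchSwinnertonDyer.Theorems.KimAtThreeDeepLowerExpStarOmega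
open Summit.BirchSwinnertonDyer.BirchSwinnertonDyer.Theorems.KimAtThreeDeepLowerExpStarOmegaPlace
open Summit.BirchSwinnertonDyer.BirchSwinnertonDyer.Theorems.KimAtThreeDeepUpperExpStarTransport
open Summit.BirchSwinnertonDyer.BirchSwinnertonDyer.Theorems.KimAtThreeDeepUpperExpStarFacts
open Summit.BirchSwinnertonDyer.BirchSwinnertonDyer.Theorems.KimAtThreeDeepUpperExpStarFactsCanonical
  (ringHom_place_padic_ext)
open Summit.BirchSwinnertonDyer.Rank1Residual.GaloisImage
open Summit.BirchSwinnertonDyer.Rank1Residual.Additive (LocalLog.padicLog)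
open Rat.HeightOneSpectrum

namespace Summit.BirchSwinnertonDyer.BirchSwinnertonDyer.Theorems.SemiLocalIntegrality

/-! ## §1 The tower of a completion of `ℚ(ζ_m)` lands in `Gal(ℚ̄/ℚ(μ_m))`, for every `m` -/

section Tower

variable (p : ℕ) [hp : Fact p.Prime] (m : ℕ) [NeZero m]

set_option backward.isDefEq.respectTransparency false in
/-- **The tower restriction `Γ_{ℚ(ζ_m)_w} → Γ_{ℚ_v} → Γ_ℚ` lands in `rootsOfUnityFixer ℚ m`**, for EVERY level
`m ≥ 1`, every prime `p` and every place `w` of `ℚ(ζ_m)` over `v_p` (the completion contains the image of `ζ_m`, and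
`IsScalarTower ℚ ℚ_v ℚ(ζ_m)_w` holds because ring maps out of `ℚ` are unique). The `hσ` binder of the P1 draft's
(DEF_w) clause; `p`- and `m`-generic twin of the private `Kato2004.absGaloisRestrictTower_completion_mem_cycSubgroup`.
[cite: Rubin2000, Ch. III §2.1] [cite: NeukirchANT1999, Ch. IV §1] -/
theorem absGaloisRestrictTower_adicCompletion_mem_rootsOfUnityFixer
    (w : ((primesEquiv (R := 𝓞 ℚ)).symm ⟨p, hp.out⟩).Extension (𝓞 (CyclotomicField m ℚ)))
    (σ : absoluteGaloisGroup (w.1.adicCompletion (CyclotomicField m ℚ))) :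
    absGaloisRestrictTower ℚ (((primesEquiv (R := 𝓞 ℚ)).symm ⟨p, hp.out⟩).adicCompletion ℚ)
      (w.1.adicCompletion (CyclotomicField m ℚ)) σ ∈ rootsOfUnityFixer ℚ m := by
  have hcomp : algebraMap ℚ (w.1.adicCompletion (CyclotomicField m ℚ)) =
      (algebraMap (((primesEquiv (R := 𝓞 ℚ)).symm ⟨p, hp.out⟩).adicCompletion ℚ)
        (w.1.adicCompletion (CyclotomicField m ℚ))).comp
        (algebraMap ℚ (((primesEquiv (R := 𝓞 ℚ)).symm ⟨p, hp.out⟩).adicCompletion ℚ)) :=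
    Subsingleton.elim _ _
  haveI hST : IsScalarTower ℚ (((primesEquiv (R := 𝓞 ℚ)).symm ⟨p, hp.out⟩).adicCompletion ℚ)
      (w.1.adicCompletion (CyclotomicField m ℚ)) := IsScalarTower.of_algebraMap_eq' hcomp
  have hζ := ((IsCyclotomicExtension.zeta_spec m ℚ (CyclotomicField m ℚ)).map_of_injective
    (algebraMap (CyclotomicField m ℚ) (w.1.adicCompletion (CyclotomicField m ℚ))).injective)
  exact absGaloisRestrictTower_mem_rootsOfUnityFixer ℚ _ _ hζ σ

end Tower

/-! ## §2 The PIN in (S5b)'s Literature currency gives W2's `hdual` -/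

section Pin

variable (W : WeierstrassCurve ℚ) [W.IsElliptic] (p : ℕ) [Fact p.Prime]
  (v : HeightOneSpectrum (𝓞 ℚ)) [hv : Fact (((p : ℕ) : 𝓞 ℚ) ∈ v.asIdeal)]

-- FILE-LOCAL instance keys, byte-identical to the accepted `KimAtThreeDeepUpperExpStarFacts.lean` l.76–79 (no library
-- instance is overridden outside this file): the tree's `ℚ`-algebra structure on `ℚ_v` first, then the local-field
-- structures on `ℚ_v = Place.Completion (inr v)` under which the W2 cell's `exp*_ω` API is stated.
attribute [local instance 100000] NumberField.Place.instAlgebraCompletion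
attribute [local instance] valuativeRelPlace topologicalSpacePlace
attribute [local instance] isNonarchimedeanLocalField_place charZero_place
attribute [local instance] padicAlgebraPlace fact_not_isUnit_place isAdicComplete_place

/-- **P1's PIN ⟹ W2's `hdual`, for every `ι : ℚ_v →+* ℚ_p`.** If the range of the Literature coordinate
`expStarCoord W _ d` on crossed homomorphisms of `T_pW|_{Γ_{ℚ_v}}` is, for EVERY compatible `wv` on `ℚ_v` making
`W ⊗ ℚ_v` integral, the set `{a : ∀ P, ‖Tr_{ℚ_v/ℚ_p}(a · padicLogPointFiniteExt wv (W ⊗ ℚ_v) p P)‖ ≤ 1}` (the P1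
draft's (PIN) clause — (S5b)'s right-hand side with `e = 1`), then for every `ι` the range of
`expStarOmegaPadicAt d hinj hex ι` on CLASSES is `{a : ∀ Q ∈ E(ℚ_p), ‖a · log_ω Q‖ ≤ 1}` (`log_ω = LocalLog.padicLog`).
Proof = the reading of `KimAtThreeDeepUpperExpStarFacts.hdual_of_facts`: PIN at `wv := ‖padicEquiv ·‖`,
`Tr_{ℚ_v/ℚ_p} = padicEquiv`, transport of points and logarithms along `padicEquiv`, rigidity `ι = padicEquiv`.
[cite: Kato1993LNM1553, Ch. II §1.2.4, Thm. 1.4.1 (3)–(4)] [cite: BlochKato1990, Prop. 3.8 and Example 3.11]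
[cite: SerreLocalFields1979, Ch. II §5] -/
theorem hdual_of_pin [W.IsGloballyMinimal] (d : LocalNeronLineAt W p v)
    (hinj : (bdRPeriodRingData (valuation_place_lt_one p v)).CupLogInjective (logCyclotomic p)
      (localRationalTateRep W p (galRestrictPlace v)))
    (hex : ∀ z : contOneCocycles (localRationalTateRep W p (galRestrictPlace v)).toTopRep,
      (bdRPeriodRingData (valuation_place_lt_one p v)).HasDualExp (logCyclotomic p)
        (localRationalTateRep W p (galRestrictPlace v)) fun σ => z.1 σ)
    (hPIN : ∀ (wv : Valuation (Place.Completion (Sum.inr v : Place ℚ)) ℝ≥0) [wv.Compatible]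
        [(W.baseChange (Place.Completion (Sum.inr v : Place ℚ))).IsIntegral wv.integer],
      ∀ a : Place.Completion (Sum.inr v : Place ℚ),
        (∃ η : contOneCocycles (restrictedTateRep W (Place.Completion (Sum.inr v : Place ℚ)) p).toTopRep,
            expStarCoord W (valuation_place_lt_one p v) d η = a) ↔
          ∀ P : (W.baseChange (Place.Completion (Sum.inr v : Place ℚ))).toAffine.Point,
            ‖Algebra.trace ℚ_[p] (Place.Completion (Sum.inr v : Place ℚ))
                (a * padicLogPointFiniteExt wv (W.baseChange (Place.Completion (Sum.inr v : Place ℚ))) p P)‖ ≤ 1)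
    (ι : Place.Completion (Sum.inr v : Place ℚ) →+* ℚ_[p]) :
    ∀ a : ℚ_[p], (∃ y, expStarOmegaPadicAt d hinj hex ι y = a) ↔
      ∀ Q : (W.baseChange ℚ_[p]).toAffine.Point, ‖a * LocalLog.padicLog (W.baseChange ℚ_[p]) Q‖ ≤ 1 := by
  have hpv : ((p : ℕ) : 𝓞 ℚ) ∈ v.asIdeal := hv.out
  have hp' := primesEquiv_eq p v hpv
  subst hp'
  -- the isomorphism `ℚ_v ≃ ℚ_p` and the transported `p`-adic norm
  let eA0 : v.adicCompletion ℚ ≃ₐ[ℚ] ℚ_[((primesEquiv v : Nat.Primes) : ℕ)] :=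
    (adicCompletion.padicEquiv (R := 𝓞 ℚ) v).toAlgEquiv
  let eA : Place.Completion (Sum.inr v : Place ℚ) ≃ₐ[ℚ] ℚ_[((primesEquiv v : Nat.Primes) : ℕ)] := eA0
  have hcont : Continuous eA0.symm := (adicCompletion.padicEquiv (R := 𝓞 ℚ) v).symm.continuous
  let w' : Valuation (v.adicCompletion ℚ) ℝ≥0 :=
    (NormedField.valuation (K := ℚ_[((primesEquiv v : Nat.Primes) : ℕ)])).comap
      (eA0 : v.adicCompletion ℚ →+* _)
  let w : Valuation (Place.Completion (Sum.inr v : Place ℚ)) ℝ≥0 := w'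
  have hw : ∀ x, w' x = ‖eA0 x‖₊ := fun x => rfl
  haveI : w.Compatible := compatible_of_norm_algEquiv _ v eA0 w' hw (norm_padicEquiv_le_one_iff v)
  haveI hIv : (W.baseChange (v.adicCompletion ℚ)).IsIntegral w'.integer :=
    isIntegral_baseChange_of_norm_algEquiv eA0 hw W
  haveI : (W.baseChange (Place.Completion (Sum.inr v : Place ℚ))).IsIntegral w.integer := hIv
  -- rigidity: `ι = padicEquiv`
  rw [ringHom_place_padic_ext _ v ι (eA : Place.Completion (Sum.inr v : Place ℚ) →+* _)]
  intro a
  have key := hPIN w (eA.symm a)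
  -- LEFT: classes vs crossed homomorphisms, `ℚ_p` vs `ℚ_v` values
  have hL : (∃ y, expStarOmegaPadicAt d hinj hex (eA : Place.Completion (Sum.inr v : Place ℚ) →+* _) y = a) ↔
      ∃ η : contOneCocycles (restrictedTateRep W (Place.Completion (Sum.inr v : Place ℚ)) _).toTopRep,
        expStarCoord W (valuation_place_lt_one _ v) d η = eA.symm a := by
    constructor
    · rintro ⟨y, hy⟩
      obtain ⟨η, rfl⟩ := oneCocycleClass_surjective _ y
      refine ⟨η, ?_⟩
      rw [expStarOmegaPadicAt_apply, expStarOmegaAt_eq_expStarCoord] at hy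
      rw [← hy]
      exact (eA.symm_apply_apply _).symm
    · rintro ⟨η, hη⟩
      refine ⟨oneCocycleClass _ η, ?_⟩
      rw [expStarOmegaPadicAt_apply, expStarOmegaAt_eq_expStarCoord, hη]
      exact eA.apply_symm_apply a
  -- RIGHT: trace = `eA`, points and logarithms transported along `eA`
  haveI := isIntegral_valuationInteger_of_isIntegral_padicInt
    (W.baseChange ℚ_[((primesEquiv v : Nat.Primes) : ℕ)])
  have hlog : ∀ P : (W.baseChange (Place.Completion (Sum.inr v : Place ℚ))).toAffine.Point,
      eA (eA.symm a * padicLogPointFiniteExt w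
          (W.baseChange (Place.Completion (Sum.inr v : Place ℚ))) ((primesEquiv v : Nat.Primes) : ℕ) P) =
        a * LocalLog.padicLog (W.baseChange ℚ_[((primesEquiv v : Nat.Primes) : ℕ)])
          (WeierstrassCurve.Affine.Point.map (eA : Place.Completion (Sum.inr v : Place ℚ) →ₐ[ℚ] _) P) := by
    intro P
    rw [map_mul, AlgEquiv.apply_symm_apply, padicLog_eq_padicLogPointFiniteExt]
    congr 1
    exact (padicLogPointFiniteExt_map_algEquiv eA0 hw W P).symm
  have htr : ∀ x : Place.Completion (Sum.inr v : Place ℚ),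
      Algebra.trace ℚ_[((primesEquiv v : Nat.Primes) : ℕ)] (Place.Completion (Sum.inr v : Place ℚ)) x = eA x :=
    fun x => trace_eq _ v eA0 hpv hcont x
  have hR : (∀ P : (W.baseChange (Place.Completion (Sum.inr v : Place ℚ))).toAffine.Point,
      ‖Algebra.trace ℚ_[((primesEquiv v : Nat.Primes) : ℕ)] (Place.Completion (Sum.inr v : Place ℚ))
          (eA.symm a * padicLogPointFiniteExt w
            (W.baseChange (Place.Completion (Sum.inr v : Place ℚ))) ((primesEquiv v : Nat.Primes) : ℕ) P)‖ ≤ 1) ↔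
      ∀ Q : (W.baseChange ℚ_[((primesEquiv v : Nat.Primes) : ℕ)]).toAffine.Point,
        ‖a * LocalLog.padicLog (W.baseChange ℚ_[((primesEquiv v : Nat.Primes) : ℕ)]) Q‖ ≤ 1 := by
    constructor
    · intro h Q
      obtain ⟨P, rfl⟩ := exists_map_algEquiv_eq eA0 W Q
      have hP := h P
      rwa [htr, hlog] at hP
    · intro h P
      rw [htr, hlog]
      exact h _
  exact hL.trans (key.trans hR)

end Pin

/-! ## §3 P4-coh in the P1 draft's currency: `Ψ (Λ y) w ∈ 𝒪_w` for every `y`, `w` -/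

section Hint

open Summit.BirchSwinnertonDyer.BirchSwinnertonDyer.Theorems.KimAtThreeDeepLowerExpStarOmegaRes
open Summit.BirchSwinnertonDyer.BirchSwinnertonDyer.Theorems.KimAtThreeDeepUpperExpStarFactsTower
open Summit.BirchSwinnertonDyer.BirchSwinnertonDyer.Theorems.KimAtThreeDeepUpperTowerLattice
  (fact_natCast_mem_primesEquiv_symm)
open Summit.BirchSwinnertonDyer.BirchSwinnertonDyer.Theorems.KimAtThreeFineKatoLevelCompat
  (exists_level_towerCocycle)
open Summit.BirchSwinnertonDyer.BirchSwinnertonDyer.Theorems.KPort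
open Literature.NumberTheory.EllipticCurves.Kato2004 Literature.NumberTheory.EllipticCurves.Kato2004.EulerSystemValues
open Literature.NumberTheory.AdelicBaseChange Literature.NumberTheory.Automorphic

variable (p : ℕ) [hp : Fact p.Prime]

-- FILE-LOCAL instance keys, byte-identical to the accepted `KimAtThreeDeepUpperTowerLattice.lean` l.92–98 (no library
-- instance is overridden outside this file): the `Fact (p ∈ v_p)` key and the `ℚ_v` structure keys of §2 again.
attribute [local instance] fact_natCast_mem_primesEquiv_symm
-- the tree's `ℚ`-algebra structure on `ℚ_v` first (see `KimAtThreeDeepUpperExpStarFacts`)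
attribute [local instance 100000] NumberField.Place.instAlgebraCompletion
attribute [local instance] valuativeRelPlace topologicalSpacePlace
attribute [local instance] isNonarchimedeanLocalField_place charZero_place
attribute [local instance] padicAlgebraPlace fact_not_isUnit_place isAdicComplete_place

set_option backward.isDefEq.respectTransparency false in
set_option maxHeartbeats 1600000 in
/-- ★★★ **P4-coh in the P1 draft's currency — the `hint` binder of P4-core.** Let `W/ℚ` be globally minimal with
`5 ≤ p` additive (`Addv W p`), `d₀` a generator of `D⁰_dR(V_pW|_{Γ_{ℚ_v}})` carrying the P1 draft's (PIN) clause
VERBATIM (Néron range of `expStarCoord W _ d₀`, for every compatible `wv` on `ℚ_v`), `m` a level with `p ∤ m`, F″'s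
clause `7 < p ∨ (Nat.Coprime (orderOf (p : ZMod m)) (p − 1) ∧ ∀ P : E(ℚ_p), p • P = 0 → P = 0)`, `Λ` a value map on
`H¹(ℚ(μ_m), T_pW) = H1 (tateRep W p) (rootsOfUnityFixer ℚ m)`, `Ψ` ANY map to `∏_{w ∣ p} ℚ(ζ_m)_w`, and `hSEMI` the
P1 draft's per-place clause VERBATIM (for every `w ∣ p`: a line datum `dw` of the tower representation at `L_w` with
(RES_w) and (DEF_w) `Ψ (Λ y) w = exp*_{dw}(ψT)` for every cocycle `φ''` of `y` and its tower cocycle `ψT`). Then,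
GRANTED the cite facts (S5b-tower) `hT₂` and Kato's Prop. 1.2.3 `hP`/`hDR` (displayed): **`Ψ (Λ y) w ∈ 𝒪_w` for
every `y` and every `w ∣ p`** — the hypothesis `hint` of
`SemiLocalDescent.exists_not_dvd_isIntegral_charSum_of_forall_semilocal_mem` (p598912). Proof: instantiate `hSEMI` at
`w` with the packet's structure proofs; Prop. 1.2.3 at `L_w` (`isDeRham_localRationalTateRep_comp_of_facts`); (PIN) ⟹
`hdual` (§2); (RES_w) on classes (as `KimAtThreeDeepLowerKatoLit`); P4-coh part 1
`expStarOmegaHom_mem_adicCompletionIntegers_of_katoClause` (p601236) ⟹ `exp*_{dw}(H¹(L_w, T_pW)) ⊆ 𝒪_w`; a cocycle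
`φ''` of `y` and its tower cocycle `ψT` (`KimAtThreeFineKatoLevelCompat.exists_level_towerCocycle`, membership §1);
(DEF_w) and `expStarOmega_oneCocycleClass`.
[cite: Kato2004Asterisque, §9.4 (p. 188), Thm. 9.7 (p. 189)] [cite: Kato1993LNM1553, Ch. II Prop. 1.2.3, §1.2.4, Thm. 1.4.1 (3)–(4)]
[cite: BlochKato1990, §3 Prop. 3.8, Ex. 3.11] [cite: KimNakamura2020, Cor. 2.4]
[cite: CasselsFrohlichANT1967, Ch. II §10 Theorem (10.2)] -/
theorem semilocal_mem_adicCompletionIntegers_of_pin_of_semi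
    (hT₂ : exists_smul_range_expStarCoord_tower_iff_trace_log)
    (hP : cupLogInjective_and_hasDualExp_of_isDeRham) (hDR : isDeRham_restrictedRationalTateRep)
    (W : WeierstrassCurve ℚ) [W.IsElliptic] [W.IsGloballyMinimal]
    [ContinuousSMul ℤ_[p] (W.tateModule p)] [Module.Free ℤ_[p] (W.tateModule p)]
    [Module.Finite ℤ_[p] (W.tateModule p)]
    (hp5 : 5 ≤ p) (hadd : Literature.NumberTheory.EllipticCurves.Rank1Residual.Addv W p)
    (d₀ : LocalNeronLineAt W p ((primesEquiv (R := 𝓞 ℚ)).symm ⟨p, hp.out⟩))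
    (hPIN : ∀ (wv : Valuation (Place.Completion (Sum.inr ((primesEquiv (R := 𝓞 ℚ)).symm ⟨p, hp.out⟩) : Place ℚ)) ℝ≥0) [wv.Compatible]
        [(W.baseChange (Place.Completion (Sum.inr ((primesEquiv (R := 𝓞 ℚ)).symm ⟨p, hp.out⟩) : Place ℚ))).IsIntegral wv.integer],
      ∀ a : Place.Completion (Sum.inr ((primesEquiv (R := 𝓞 ℚ)).symm ⟨p, hp.out⟩) : Place ℚ),
        (∃ η : contOneCocycles (restrictedTateRep W (Place.Completion (Sum.inr ((primesEquiv (R := 𝓞 ℚ)).symm ⟨p, hp.out⟩) : Place ℚ)) p).toTopRep,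
            expStarCoord W (valuation_place_lt_one p ((primesEquiv (R := 𝓞 ℚ)).symm ⟨p, hp.out⟩)) d₀ η = a) ↔
          ∀ P : (W.baseChange (Place.Completion (Sum.inr ((primesEquiv (R := 𝓞 ℚ)).symm ⟨p, hp.out⟩) : Place ℚ))).toAffine.Point,
            ‖Algebra.trace ℚ_[p] (Place.Completion (Sum.inr ((primesEquiv (R := 𝓞 ℚ)).symm ⟨p, hp.out⟩) : Place ℚ))
                (a * padicLogPointFiniteExt wv (W.baseChange (Place.Completion (Sum.inr ((primesEquiv (R := 𝓞 ℚ)).symm ⟨p, hp.out⟩) : Place ℚ))) p P)‖ ≤ 1)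
    (m : ℕ) [NeZero m] (hpm : ¬ p ∣ m)
    (hcl : 7 < p ∨ (Nat.Coprime (orderOf (p : ZMod m)) (p - 1) ∧
      ∀ P : (W.baseChange ℚ_[p]).toAffine.Point, p • P = 0 → P = 0))
    (Λ : H1 (tateRep W p) (rootsOfUnityFixer ℚ m) →ₗ[ℤ_[p]] ℚ_[p] ⊗[ℚ] CyclotomicField m ℚ)
    (Ψ : ℚ_[p] ⊗[ℚ] CyclotomicField m ℚ ≃ₐ[ℚ]
      (Π w : ((primesEquiv (R := 𝓞 ℚ)).symm ⟨p, hp.out⟩).Extension (𝓞 (CyclotomicField m ℚ)),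
        w.1.adicCompletion (CyclotomicField m ℚ)))
    (hSEMI : ∀ (w : ((primesEquiv (R := 𝓞 ℚ)).symm ⟨p, hp.out⟩).Extension (𝓞 (CyclotomicField m ℚ))),
      ∀ (hw : ((p : ℕ) : 𝓞 (CyclotomicField m ℚ)) ∈ w.1.asIdeal)
        [CharZero (w.1.adicCompletion (CyclotomicField m ℚ))]
        [Fact (¬ IsUnit ((p : ℕ) : integerC (w.1.adicCompletion (CyclotomicField m ℚ))))]
        [IsAdicComplete (Ideal.span {((p : ℕ) : integerC (w.1.adicCompletion (CyclotomicField m ℚ)))}) (integerC (w.1.adicCompletion (CyclotomicField m ℚ)))]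
        (hL : valuation (w.1.adicCompletion (CyclotomicField m ℚ)) ((p : ℕ) : (w.1.adicCompletion (CyclotomicField m ℚ))) < 1),
      letI := LocalField.adicCompletionPadicAlgebra w.1 p hw
      letI ρVT := (W.rationalTateGaloisRep p (W.continuous_rationalGaloisRepTate_holds p)).restrict
        ((absGaloisRestrict ℚ (Place.Completion (Sum.inr ((primesEquiv (R := 𝓞 ℚ)).symm ⟨p, hp.out⟩) : Place ℚ))).comp
          (absGaloisRestrict (((primesEquiv (R := 𝓞 ℚ)).symm ⟨p, hp.out⟩).adicCompletion ℚ) (w.1.adicCompletion (CyclotomicField m ℚ))))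
      ∃ (dw : (bdRPeriodRingData hL).FilZeroLine ρVT),
        (∀ (η₀ : contOneCocycles (restrictedTateRep W (Place.Completion (Sum.inr ((primesEquiv (R := 𝓞 ℚ)).symm ⟨p, hp.out⟩) : Place ℚ)) p).toTopRep)
          (η : contOneCocycles ((restrictedTateRep W (Place.Completion (Sum.inr ((primesEquiv (R := 𝓞 ℚ)).symm ⟨p, hp.out⟩) : Place ℚ)) p).restrict
            (absGaloisRestrict (((primesEquiv (R := 𝓞 ℚ)).symm ⟨p, hp.out⟩).adicCompletion ℚ) (w.1.adicCompletion (CyclotomicField m ℚ)))).toTopRep),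
          (∀ σ, η.1 σ = η₀.1 (absGaloisRestrict (((primesEquiv (R := 𝓞 ℚ)).symm ⟨p, hp.out⟩).adicCompletion ℚ) (w.1.adicCompletion (CyclotomicField m ℚ)) σ)) →
          (bdRPeriodRingData hL).dualExpCoord (logCyclotomic p) ρVT dw.ω (fun σ => TateModule.toRational p (η.1 σ)) =
            algebraMap (((primesEquiv (R := 𝓞 ℚ)).symm ⟨p, hp.out⟩).adicCompletion ℚ) (w.1.adicCompletion (CyclotomicField m ℚ))
              (expStarCoord W (valuation_place_lt_one p ((primesEquiv (R := 𝓞 ℚ)).symm ⟨p, hp.out⟩)) d₀ η₀ :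
                Place.Completion (Sum.inr ((primesEquiv (R := 𝓞 ℚ)).symm ⟨p, hp.out⟩) : Place ℚ))) ∧
        (∀ (y : H1 (tateRep W p) (rootsOfUnityFixer ℚ m))
          (φ'' : contOneCocycles (subgroupRep (tateRep W p).toTopRep (rootsOfUnityFixer ℚ m)))
          (ψT : contOneCocycles ((restrictedTateRep W (Place.Completion (Sum.inr ((primesEquiv (R := 𝓞 ℚ)).symm ⟨p, hp.out⟩) : Place ℚ)) p).restrict
            (absGaloisRestrict (((primesEquiv (R := 𝓞 ℚ)).symm ⟨p, hp.out⟩).adicCompletion ℚ) (w.1.adicCompletion (CyclotomicField m ℚ)))).toTopRep),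
          oneCocycleClass _ φ'' = y →
          (∀ σ (hσ : absGaloisRestrictTower ℚ (((primesEquiv (R := 𝓞 ℚ)).symm ⟨p, hp.out⟩).adicCompletion ℚ) (w.1.adicCompletion (CyclotomicField m ℚ)) σ ∈
              rootsOfUnityFixer ℚ m),
            ψT.1 σ = φ''.1 ⟨absGaloisRestrictTower ℚ (((primesEquiv (R := 𝓞 ℚ)).symm ⟨p, hp.out⟩).adicCompletion ℚ) (w.1.adicCompletion (CyclotomicField m ℚ)) σ, hσ⟩) →
          Ψ (Λ y) w =
            (bdRPeriodRingData hL).dualExpCoord (logCyclotomic p) ρVT dw.ω (fun σ => TateModule.toRational p (ψT.1 σ)))) :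
    ∀ (y : H1 (tateRep W p) (rootsOfUnityFixer ℚ m))
      (w : ((primesEquiv (R := 𝓞 ℚ)).symm ⟨p, hp.out⟩).Extension (𝓞 (CyclotomicField m ℚ))),
      Ψ (Λ y) w ∈ w.1.adicCompletionIntegers (CyclotomicField m ℚ) := by
  intro y w
  -- local-field structures at `L_w`, instantiated with the packet's own terms (as the P1 draft prescribes)
  have hw : ((p : ℕ) : 𝓞 (CyclotomicField m ℚ)) ∈ w.1.asIdeal := Kw.prime_mem_asIdeal w
  letI := LocalField.charZero_adicCompletion w.1
  letI := LocalField.adicCompletionPadicAlgebra w.1 p hw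
  haveI : Fact (¬ IsUnit ((p : ℕ) : integerC (w.1.adicCompletion (CyclotomicField m ℚ)))) :=
    ⟨not_isUnit_natCast_integerC (LocalField.valuation_adicCompletion_natCast_lt_one w.1 p hw)⟩
  haveI := isAdicComplete_integerC_natCast (LocalField.valuation_adicCompletion_natCast_lt_one w.1 p hw)
  -- `Place.Completion (inr v)` is `ℚ_v` by `rfl`: read the packet's algebra structure on it
  letI instEF : Algebra (Place.Completion (K := ℚ) (Sum.inr ((primesEquiv (R := 𝓞 ℚ)).symm ⟨p, hp.out⟩)))
      (w.1.adicCompletion (CyclotomicField m ℚ)) :=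
    inferInstanceAs (Algebra (((primesEquiv (R := 𝓞 ℚ)).symm ⟨p, hp.out⟩).adicCompletion ℚ)
      (w.1.adicCompletion (CyclotomicField m ℚ)))
  have hcont : Continuous (algebraMap (Place.Completion (K := ℚ) (Sum.inr ((primesEquiv (R := 𝓞 ℚ)).symm ⟨p, hp.out⟩)))
      (w.1.adicCompletion (CyclotomicField m ℚ))) :=
    w.adicCompletionSemialgHom_continuous ℚ (CyclotomicField m ℚ)
  -- the per-place clause of the datum at `w`
  obtain ⟨dw, hres, hdef⟩ := hSEMI w hw (LocalField.valuation_adicCompletion_natCast_lt_one w.1 p hw)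
  -- Kato's Prop. 1.2.3 binders at the base and at `L_w` (cite facts `hP`, `hDR`)
  obtain ⟨hinj, hex⟩ := hinj_hex_of_facts W p ((primesEquiv (R := 𝓞 ℚ)).symm ⟨p, hp.out⟩) hP hDR
  haveI : Module.Finite ℚ_[p] (W.rationalTateModule p) := WeierstrassCurve.module_finite_rationalTateModule_holds W p
  have hDRw := isDeRham_localRationalTateRep_comp_of_facts W p ((primesEquiv (R := 𝓞 ℚ)).symm ⟨p, hp.out⟩)
    (LocalField.valuation_adicCompletion_natCast_lt_one w.1 p hw) hDR hcont
  obtain ⟨hinjw, hexw⟩ := hP (LocalField.valuation_adicCompletion_natCast_lt_one w.1 p hw)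
    (localRationalTateRep W p ((galRestrictPlace ((primesEquiv (R := 𝓞 ℚ)).symm ⟨p, hp.out⟩)).comp
      (absGaloisRestrict (((primesEquiv (R := 𝓞 ℚ)).symm ⟨p, hp.out⟩).adicCompletion ℚ) (w.1.adicCompletion (CyclotomicField m ℚ))))) hDRw
  -- the PIN in W2's `hdual` shape
  have hdual := hdual_of_pin W p ((primesEquiv (R := 𝓞 ℚ)).symm ⟨p, hp.out⟩) d₀ hinj hex hPIN
    (((Padic.adicCompletionEquiv (𝓞 ℚ) ⟨p, hp.out⟩).symm : (((primesEquiv (R := 𝓞 ℚ)).symm ⟨p, hp.out⟩).adicCompletion ℚ) →+* ℚ_[p]))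
  -- (RES_w) on classes from the cocycle-level clause
  have hres' : ∀ h : (tateLocalRep W p (Sum.inr ((primesEquiv (R := 𝓞 ℚ)).symm ⟨p, hp.out⟩))).cohomology 1,
      expStarOmegaHom (LocalField.valuation_adicCompletion_natCast_lt_one w.1 p hw) ((galRestrictPlace ((primesEquiv (R := 𝓞 ℚ)).symm ⟨p, hp.out⟩)).comp (absGaloisRestrict (((primesEquiv (R := 𝓞 ℚ)).symm ⟨p, hp.out⟩).adicCompletion ℚ) (w.1.adicCompletion (CyclotomicField m ℚ)))) dw hinjw hexw
          (ContinuousRep.cohomologyRes (tateLocalRep W p (Sum.inr ((primesEquiv (R := 𝓞 ℚ)).symm ⟨p, hp.out⟩))) (absGaloisRestrict (((primesEquiv (R := 𝓞 ℚ)).symm ⟨p, hp.out⟩).adicCompletion ℚ) (w.1.adicCompletion (CyclotomicField m ℚ))) 1 h) =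
        algebraMap (((primesEquiv (R := 𝓞 ℚ)).symm ⟨p, hp.out⟩).adicCompletion ℚ) (w.1.adicCompletion (CyclotomicField m ℚ)) (expStarOmegaAt d₀ h) := by
    intro h
    obtain ⟨η₀, rfl⟩ := oneCocycleClass_surjective _ h
    let ηp := contOneCocycles.pullback (absGaloisRestrict (((primesEquiv (R := 𝓞 ℚ)).symm ⟨p, hp.out⟩).adicCompletion ℚ) (w.1.adicCompletion (CyclotomicField m ℚ)))
      (Y := ((tateLocalRep W p (Sum.inr ((primesEquiv (R := 𝓞 ℚ)).symm ⟨p, hp.out⟩))).restrict (absGaloisRestrict (((primesEquiv (R := 𝓞 ℚ)).symm ⟨p, hp.out⟩).adicCompletion ℚ) (w.1.adicCompletion (CyclotomicField m ℚ)))).toTopRep)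
      (TopRep.ofHom ⟨ContinuousLinearMap.id ℤ (W.tateModule p), fun _ => rfl⟩) η₀
    have hcl' : (tateLocalRep W p (Sum.inr ((primesEquiv (R := 𝓞 ℚ)).symm ⟨p, hp.out⟩))).cohomologyRes (absGaloisRestrict (((primesEquiv (R := 𝓞 ℚ)).symm ⟨p, hp.out⟩).adicCompletion ℚ) (w.1.adicCompletion (CyclotomicField m ℚ))) 1
        (oneCocycleClass _ η₀) =
        oneCocycleClass (localTateRep W p ((galRestrictPlace ((primesEquiv (R := 𝓞 ℚ)).symm ⟨p, hp.out⟩)).comp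
          (absGaloisRestrict (((primesEquiv (R := 𝓞 ℚ)).symm ⟨p, hp.out⟩).adicCompletion ℚ) (w.1.adicCompletion (CyclotomicField m ℚ))))).toTopRep ηp :=
      KimAtThreeDeepLowerExpStarOmegaRes.cohomologyRes_oneCocycleClass _ _ η₀
    rw [hcl', expStarOmegaHom_apply, expStarOmega_oneCocycleClass, expStarOmegaAt_eq_expStarCoord]
    exact hres η₀ ηp fun σ => pullback_id_apply _ _ η₀ σ
  -- P4-coh part 1: the defined `exp*` of the tower representation at `L_w` is integral
  have hint := expStarOmegaHom_mem_adicCompletionIntegers_of_katoClause p hT₂ W hp5 hadd d₀ hinj hex hdual m hpm hcl w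
    dw hinjw hexw hres'
  -- a cocycle of `y` and its tower cocycle (membership by §1 of part 2)
  obtain ⟨φ'', hφ⟩ := oneCocycleClass_surjective _ y
  obtain ⟨ψT, hψT⟩ := exists_level_towerCocycle W p ((primesEquiv (R := 𝓞 ℚ)).symm ⟨p, hp.out⟩)
    (w.1.adicCompletion (CyclotomicField m ℚ)) (rootsOfUnityFixer ℚ m)
    (fun σ => absGaloisRestrictTower_adicCompletion_mem_rootsOfUnityFixer p m w σ) φ''
  have hΨ := hdef y φ'' ψT hφ (fun σ _ => hψT σ)
  rw [hΨ]
  have key := hint (oneCocycleClass _ ψT)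
  rw [expStarOmegaHom_apply, expStarOmega_oneCocycleClass] at key
  exact key

end Hint

end Summit.BirchSwinnertonDyer.BirchSwinnertonDyer.Theorems.SemiLocalIntegrality

end
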